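/- Copyright: the b2b-balaban cell (near-miss cell 7), T⁴-continuum fan-out, ROUND-2 swarm `t4-ne7b-formalise-*`
(leaf 01), row NE7b (node U5c COUNT member).  Released under the licence of the surrounding project. -/
import Summits.QuantumFields.BalabanUV.T4Continuum.Support.HistoryGenealogyRealiseOrder
import Literature.MathematicalPhysics.QuantumFieldTheory.Balaban1983to89.B13Ineq232

/-!
# The collar of a touching cluster of face-connected domains is face-connected (geometric input of the junction M4,
owner design memo D-M4-3 ∕ located open point G-M4-1 «fresh touching clusters»; row NE7b, INTERFACE REQUEST IR-41-3 (i)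
of the row's CRUX prover t4-ne7b-p1 gen 41, `HOME/INBOX.md` block of 2026-08-21T04:38Z — drafted by leaf-01 gen 24,
filed by leaf-01 gen 25)

Summits-side support leaf of the T⁴-continuum cell (rung (B)+1 on a FINITE torus only; NOT infinite volume, NOT the
mass gap, NOT the Clay statement; NOT a proof of the spine estimate NE7b, which is the cell's OWN estimate, NOT PRINTED
and NOT PROVED).  [folklore] finite geometry over b02's `B16MergeGeometry` (`Touch`, `touchGraph`, `fam`,
`Step.Budget.GConn`), [I] §3's index model `B13ScaleTransfer` (`block`, `collar`, `FaceConnected`, `faceConnected_collar`),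
`B13Ineq232.faceConnected_union`, and row S14's ORDER module (`ChainTouch`, `unionL`, `exists_chainTouch_enum_of_gconn`)
BY NAME; nothing printed is asserted, no `def … : Prop` fact, no cite-tagged hypothesis, no `def`, zero `sorry`.
B16 = [Balaban1989LargeFieldII] p. 385 is a manuscript UNDER AUDIT and appears only as a LOCATOR: the cover
«Z ⊂ ⋃_i (Z₁^{(i)})^{~2}» ((1.76)) vs the class bound «d′₁(Z) ≤ Σ d′₁((Z₁^{(i)})^{~3})» — ONE MORE layer than the cover,
which is exactly what turns a TOUCHING family into a FACE-connected union (a touch may be diagonal in `d ≥ 2`).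

WHAT IS PROVED.  `mem_block_of_touch` ∕ `touch_of_mem_block` (a touch is membership in the `3^d`-block),
`mem_collar_of_touch`, `collar_union`, `collar_empty`, `faceConnected_empty`, **`faceConnected_collar_unionL`** (the collar
of the `unionL` of a leaf-first touching chain of face-connected domains is face-connected — induction on `ChainTouch`:
the head's collar and the tail's collar share the touched cube), `fam_toFinset_eq_unionL` (`fam P l.toFinset = unionL
(l.map P)`), **`faceConnected_collar_fam_of_gconn`** (for a `GConn` block of the touch graph with face-connected members,
`FaceConnected (collar (fam P S))`), `collar_fam_eq` (`collar (fam P S) = fam (collar ∘ P) S`).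

HONEST.  Proves nothing of Bałaban's; BY-NAME EFFECT ON THE WALL: NONE; NE7b NOT proved; spine 0∕9.  HONEST DEPENDENCY
(cell): continuum YM on T⁴ ⇐ BetaPertH ∧ nine spine estimates (0/9 proved); BetaPertH ⇐ (D1) ∧ (D4) ∧ CAP+tail;
G-an2-4 gates asym, D1 and NE2/3/4.  This file changes none of it. -/

open Finset
open Literature.MathematicalPhysics.QuantumFieldTheory.Balaban1983to89
open Literature.MathematicalPhysics.QuantumFieldTheory.Balaban1983to89.B13ScaleTransfer
open Literature.MathematicalPhysics.QuantumFieldTheory.Balaban1983to89.B13Ineq232 (faceConnected_union)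
open Literature.MathematicalPhysics.QuantumFieldTheory.Balaban1983to89.B16MergeGeometry
open Literature.MathematicalPhysics.QuantumFieldTheory.Balaban1983to89.Step.Budget
open Summit.QuantumFields.BalabanUV.T4Continuum.HistoryGenealogyRealise

namespace Summit.QuantumFields.BalabanUV.T4Continuum.HistoryClusterFaceConnected

variable {d : ℕ}

/-- a touch is membership in the `3^d`-block [folklore] -/
theorem mem_block_of_touch {a c : Pt d} (h : Touch a c) : c ∈ block a :=
  mem_block.2 fun i => ⟨by have := (h i).1; omega, (h i).2⟩

/-- conversely [folklore] -/
theorem touch_of_mem_block {a c : Pt d} (h : c ∈ block a) : Touch a c :=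
  fun i => ⟨by have := (mem_block.1 h i).1; omega, (mem_block.1 h i).2⟩

/-- a cube touched by a member of `A` lies in `collar A` [folklore] -/
theorem mem_collar_of_touch {A : Finset (Pt d)} {a c : Pt d} (ha : a ∈ A) (h : Touch a c) : c ∈ collar A :=
  Finset.mem_biUnion.2 ⟨a, ha, mem_block_of_touch h⟩

/-- the collar distributes over unions [folklore] -/
theorem collar_union (A B : Finset (Pt d)) : collar (A ∪ B) = collar A ∪ collar B :=
  Finset.union_biUnion

/-- the collar of the empty family is empty [folklore] -/
@[simp] theorem collar_empty : collar (∅ : Finset (Pt d)) = ∅ := Finset.biUnion_empty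

/-- the empty family is (vacuously) face-connected [folklore] -/
theorem faceConnected_empty : FaceConnected (∅ : Finset (Pt d)) := fun x hx => absurd hx (Finset.notMem_empty x)

/-- **THE COLLAR OF A LEAF-FIRST TOUCHING CHAIN OF FACE-CONNECTED NONEMPTY DOMAINS IS FACE-CONNECTED** [folklore] -/
theorem faceConnected_collar_unionL :
    ∀ L : List (Finset (Pt d)), (∀ A ∈ L, FaceConnected A) → ChainTouch L → FaceConnected (collar (unionL L))
  | [], _, _ => by simpa using (faceConnected_empty (d := d))
  | [A], h, _ => by
      simpa [unionL] using faceConnected_collar (h A (by simp))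
  | A :: B :: L, h, hct => by
      obtain ⟨⟨a, ha, c, hc, hac⟩, hrest⟩ := (chainTouch_cons_cons A B L).1 hct
      have ih := faceConnected_collar_unionL (B :: L) (fun X hX => h X (List.mem_cons_of_mem A hX)) hrest
      rw [unionL_cons, collar_union]
      exact faceConnected_union (faceConnected_collar (h A (by simp))) ih
        ⟨c, Finset.mem_inter.2 ⟨mem_collar_of_touch ha hac, subset_collar _ hc⟩⟩

/-- the union of a subfamily listed without repetition is the `unionL` of the listed images [folklore] -/
theorem fam_toFinset_eq_unionL {ι : Type*} [DecidableEq ι] (P : ι → Finset (Pt d)) :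
    ∀ l : List ι, fam P l.toFinset = unionL (l.map P)
  | [] => by simp [fam]
  | a :: l => by
      rw [List.toFinset_cons, List.map_cons, unionL_cons, ← fam_toFinset_eq_unionL P l]
      simp [fam, Finset.biUnion_insert]

/-- **FOR EVERY CONNECTED BLOCK OF THE TOUCH GRAPH, THE COLLAR OF THE UNION IS FACE-CONNECTED** (the geometric input of
D-M4-3: a cluster of touching face-connected new regions, enlarged by one more layer, is face-connected — print's `~3` over the
`~2` cover of p. 385). [folklore] -/
theorem faceConnected_collar_fam_of_gconn {ι : Type*} [DecidableEq ι] (P : ι → Finset (Pt d)) {S : Finset ι}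
    (hP : ∀ i ∈ S, FaceConnected (P i)) (hG : GConn (touchGraph P) S) : FaceConnected (collar (fam P S)) := by
  obtain ⟨l, -, hlS, hct⟩ := exists_chainTouch_enum_of_gconn P hG
  rw [← hlS, fam_toFinset_eq_unionL]
  refine faceConnected_collar_unionL (l.map P) (fun A hA => ?_) hct
  obtain ⟨i, hi, rfl⟩ := List.mem_map.1 hA
  exact hP i (hlS ▸ List.mem_toFinset.2 hi)

/-- the same for the collar applied to EACH member first (`collar ∘ P`): equal sets [folklore] -/
theorem collar_fam_eq {ι : Type*} [DecidableEq ι] (P : ι → Finset (Pt d)) (S : Finset ι) :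
    collar (fam P S) = fam (fun i => collar (P i)) S := by
  simp only [fam, collar, Finset.biUnion_biUnion]

end Summit.QuantumFields.BalabanUV.T4Continuum.HistoryClusterFaceConnected
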